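import Literature.NumberTheory.EllipticCurves.BSDRootNumber
import HarnessLib

/-!
# Discharge of a named fact of `BSDRootNumber.lean`: the chosen continuation of `Λ(E,s)`

D-0014 keeps `Literature/` sorry-free by stating cited results as named facts `def X : Prop`.
This sibling file of `Literature.NumberTheory.EllipticCurves.BSDRootNumber` proves, as
`theorem X_holds : X`, the **bsd.S08** fact

* `Literature.NumberTheory.EllipticCurves.completedLContinuation_eq_completedLFunction`: for an elliptic curve `E/ℚ` given by
  `W`, the chosen entire continuation `W.completedLContinuation N_E` of the completed L-function
  agrees with the raw product `W.completedLFunction N_E s = N_E^{s/2} (2π)^{-s} Γ(s) L(E,s)` on the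
  half-plane `Re s > 3/2` (`N_E = W.conductorNorm ℤ`).

It is kept apart from the sibling `BSDRootNumberProofs` (parity of the analytic rank, **bsd.S36**,
which imports the modular-forms prelude) because the present discharge needs nothing beyond
`BSDRootNumber` itself.

## The proof, and what it does *not* use

Mathematically the statement is part of the package "`Λ(E,s)` extends to an entire function
satisfying `Λ(E, 2 − s) = w(E) Λ(E, s)`", which follows from the modularity of `E`
(Breuil–Conrad–Diamond–Taylor, JAMS 14 (2001), Thm A, p. 843: *"If `E/ℚ` is an elliptic curve,
then `E` is modular"*; equivalently, loc. cit. p. 845 (2), `L(E,s) = L(f,s)` for an eigenform `f`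
of weight `2` and level `N(E)`) together with Hecke's theory of the L-function of `f`.

The Lean statement, however, holds by the definition of
`WeierstrassCurve.completedLContinuation` (`RootNumber.lean`) alone:
`W.completedLContinuation N = if h : (W.completedLContinuations N).Nonempty then h.some else
W.completedLFunction N`, where `W.completedLContinuations N` is the set of entire `Λ` with
`Λ s = W.completedLFunction N s` for `Re s > 3/2`. In the first branch the chosen `Λ` agrees with
the raw product on `Re s > 3/2` by membership; in the second (the documented junk value) it *is*
the raw product. No modularity input is used, and the hypothesis `[W.IsElliptic]` of the fact is
not needed by the proof. The genuinely modular content — that the first branch is the one taken —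
is the separate named fact `WeierstrassCurve.nonempty_completedLContinuations`
(`RootNumber.lean`), not discharged here; the conditional derivation of **bsd.S08** from the
functional equation is
`Literature.NumberTheory.EllipticCurves.completedLContinuation_eq_completedLFunction_of_completedLFunction_functional_equation`
in `BSDRootNumberProofs`.

## References

* C. Breuil, B. Conrad, F. Diamond, R. Taylor, *On the modularity of elliptic curves over `ℚ`:
  wild 3-adic exercises*, J. Amer. Math. Soc. 14 (2001), 843–939, Thm A (p. 843), and p. 845 (2).
* J. H. Silverman, *The Arithmetic of Elliptic Curves*, 2nd ed., GTM 106 (2009), App. C §16.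
-/

noncomputable section

open scoped Classical

namespace Literature.NumberTheory.EllipticCurves

variable (W : WeierstrassCurve ℚ)

/-- Discharge of `completedLContinuation_eq_completedLFunction` (Breuil–Conrad–Diamond–Taylor,
JAMS 14 (2001), Thm A, p. 843: "If `E/ℚ` is an elliptic curve, then `E` is modular", whence, with
Hecke, the entire continuation of `Λ(E,s)`). The Lean statement holds by the definition of
`WeierstrassCurve.completedLContinuation` alone, with no modularity input: if an entire
continuation exists, the classically chosen one lies in `W.completedLContinuations N_E`, whose
members agree with the raw product `N_E^{s/2} (2π)^{-s} Γ(s) L(E,s)` on `Re s > 3/2` by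
definition; otherwise the chosen function *is* the raw product (the documented junk value of
`completedLContinuation`). The existence of the entire continuation itself is the separate named
fact `WeierstrassCurve.nonempty_completedLContinuations`. [cite: BCDTJAMS2001, Thm A] -/
theorem completedLContinuation_eq_completedLFunction_holds :
    completedLContinuation_eq_completedLFunction W := by
  intro _ s hs
  unfold WeierstrassCurve.completedLContinuation
  split_ifs with h
  · exact h.some_mem.2 s hs
  · rfl

end Literature.NumberTheory.EllipticCurves

end
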